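import Literature.MathematicalPhysics.QuantumLattice.DWaveSourceGSClassWindowCertificate
import Summits.Ventures.CertifiedManyBodySolver.Observables.SourcedRowsThermodynamicLimit
import Summits.Ventures.CertifiedManyBodySolver.Rows.SourcedTIClassNodeShapes
import HarnessLib

/-!
# PINNING-FIELD rows: the GROUND-STATE-CLASS node shapes of sourced certificates WITH `eom` / `kkt` rows
# (K-legs: pair-amplitude MIN / MAX with ground-state rows and a certified cap CELL), thermodynamic-limit vocabulary

HONEST FRAMING: soundness glue; no certificate, no number, no order parameter, no phase word. A finite-`h` response bound
is a response, never an order parameter (cell hubbard-cq wording W1); `m⋆ = −∂⁺E(0)/2` is not touched.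

WHAT THIS FILE IS (cell hubbard-cq, D-0082 (c) / LADDER row PC-a, seat hubbard-cq-obsth-1 «pinning-field K5 menu nodes with
the pinning term»). The cell's K-legs (card `sourced-kkt-one-point-floor`: job K, K1a+E, KZ/K1m of hubbard-cq-pilot-1 and -pilot-2) are
sourced gbT certificates whose dual identity carries GROUND-STATE rows (`eom` commutators, a `kkt` block) besides the
flip-twisted `D₄ × flip` defects and an energy CAP row `κ (u·1 − E^{src,tt'})` fed by a certified cluster cap. On finite tori
they are read by `Rows/SourcedTorusRowsTwistedFlipHook` (`pinFieldResponseFloorAt_of_onePoint_twistedFlip_window_certificate_kkt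
[_of_energyUpperRow]`: `∃ L₀, PinFieldResponseFloorAt tp U μ h q L₀ (r/2)`). THIS file gives the same identity its
THERMODYNAMIC-LIMIT sentences, by the reader `Literature/…/DWaveSourceGSClassWindowCertificate` (hubbard-cq-obsth-1 g5):

* the CLASS sentence «for every translation-invariant ground state `σ` of `Φ(1,tp,U) − μn − h P_d` (mean-energy minimiser
  = Bratteli–Kishimoto–Robinson ground state; all torus limits of sourced ground-state vectors are in the class):
  `m ≤ Re σ(P₀^d)`» (`gsClass_re_expect_localPairAt_ge_of_twistedFlip_certificate_kkt_of_energyUpperRow`; slot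
  `2m ≤ c − Σ‖aₖ‖`, tree units — the engine's `m̃ = √2·Re σ(P₀^d)` version is `…sqrt_two_mul…`), the cap row being
  DISCHARGED STATE-FREE by the cell's uniform cap CELL `SourcedEnergyUpperRow tp U μ h q L₀ u` (any progression `q ≥ 1`;
  hubbard-cq-obsth-2's `SourcedEnergyUpperRow.dWaveSourceEnergyDensityTT'_le`: `E(h) ≤ u`, and `e^{src}(σ) = E(h)` on the class);
* the STATE-FREE sentence on Griffiths' left edge: `m ≤ −∂⁻E(h)/2`, `E = dWaveSourceEnergyDensityTT' tp U μ`
  (`gsClass_neg_leftDeriv_ge_of_twistedFlip_certificate_kkt_of_energyUpperRow`) — the smallest pair amplitude over the class,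
  attained; this is the SAME object the cell's h-chords bound from below (`(E(h₁) − E(h))/(2(h − h₁)) ≤ −∂⁻E(h)/2`, concavity),
  so a K-leg floor and a chord floor at one field are directly comparable numbers;
* the MAX twins (`…_le_…`: `Re σ(P₀^d) ≤ M` on the class, `−∂⁺E(h)/2 ≤ M` state-free, slot `−(c − Σ‖aₖ‖) ≤ 2M`).

Identity shape (CONSUMER-GRAMMAR-KKT.md §8 = the torus shape; §10 = this reading): objective `±(Γ P₀^d + (Γ P₀^d)ᴴ)`, constant
`c`, cap row `κ⁺ ((u:ℚ)·1 − Γ E^{src}_h)` with `E^{src}_h = (hubbardTTPrimeSourcedInteraction 1 tp U μ dWaveFormFactor h).meanEnergyObs 1`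
embedded from `thicken {0} 1` (NO filling rows, NO unsourced floor row: grand-canonical class), RHS `gramForm Λm O +
(Σ_{k∈s} (H Γ Bₖ − Γ Bₖ H) + Σₗ flip-twisted defects) + (Σ dc•(Vᴴ−V) + Σ a•W) + kktForm H G (Γ ∘ Bk)`,
`H = pairSourceWindowHamiltonianTT' dWaveFormFactor Λ' tp U μ h`, `Bₖ, Bk_b ∈ 𝔄_Λ` arbitrary, `thicken Λ 1 ⊆ Λ'`.
Interface note: no local instance, no definition, no named fact, no `sorry`.

References: J. Wang et al., PRX 14 (2024) 031006 §III [WangEtAl2024]; M. Araújo et al., arXiv:2311.18707 §3.2 Prop. 11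
[AraujoEtAl2023]; R. B. Griffiths, Phys. Rev. 152 (1966) 240 §II [Griffiths1966]; T. Koma, H. Tasaki, J. Stat. Phys. 76 (1994)
745 §1 [KomaTasaki1994]; O. Bratteli, A. Kishimoto, D. W. Robinson, CMP 64 (1978) 41, Thm. 2 [BratteliKishimotoRobinson1978].
-/

noncomputable section

namespace Summit.Ventures.CertifiedManyBodySolver

open Literature.MathematicalPhysics.QuantumLattice Literature.MathematicalPhysics.QuantumLattice.ThermodynamicLimit
open Literature.MathematicalPhysics.QuantumManyBody.StateRelaxation
open Matrix HubbardWave0 Literature.Probability.LatticeModels Finset InfVolFermionState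
open scoped BigOperators ComplexOrder

/-! ## §1 Slot arithmetic -/

/-- `√2·M ≤ r` and `r ≤ 2x` give `M ≤ √2·x` (engine units `m̃ = √2·Re σ(P₀^d)` from the tree's `2·Re σ(P₀^d)`).
[cite: KomaTasaki1994, §1] -/
theorem le_sqrt_two_mul_of_sqrt_two_mul_le {x r M : ℝ} (hM : Real.sqrt 2 * M ≤ r) (hx : r ≤ 2 * x) : M ≤ Real.sqrt 2 * x := by
  have hs : Real.sqrt 2 * Real.sqrt 2 = 2 := Real.mul_self_sqrt (by norm_num)
  have hpos : 0 ≤ Real.sqrt 2 / 2 := div_nonneg (Real.sqrt_nonneg 2) (by norm_num)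
  calc M = Real.sqrt 2 * Real.sqrt 2 / 2 * M := by rw [hs]; ring
    _ = Real.sqrt 2 / 2 * (Real.sqrt 2 * M) := by ring
    _ ≤ Real.sqrt 2 / 2 * r := mul_le_mul_of_nonneg_left hM hpos
    _ ≤ Real.sqrt 2 / 2 * (2 * x) := mul_le_mul_of_nonneg_left hx hpos
    _ = Real.sqrt 2 * x := by ring

/-! ## §2 Response-FLOOR K-legs (pair MIN with ground-state rows and a cap cell) -/

section Floor

variable {tp U μ h : ℝ}

/-- **K-LEG FLOOR NODE SHAPE, on the ground-state class**: a grand-canonical flip-twisted sourced window certificate with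
ground-state rows (`eom` block over `s`, `kkt` block `kktForm H G (Γ ∘ Bk)`, `G ⪰ 0`), objective `Γ P₀^d + (Γ P₀^d)ᴴ` (pair MIN),
constant `c`, a cap row `κ⁺ ((u:ℚ)·1 − Γ E^{src}_h)` with `κ⁺ ≥ 0`, NO filling rows, together with a certified uniform cap CELL
`SourcedEnergyUpperRow tp U μ h q L₀ u` (`q ≥ 1`; a tiled cluster state) and a slot `2m ≤ c − Σ‖aₖ‖`, proves
`∀ σ, σ.IsMeanEnergyMinimiser (hubbardTTPrimeSourcedInteraction 1 tp U μ dWaveFormFactor h) 1 → m ≤ Re σ(P₀^d)` — a floor on the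
induced pair amplitude of EVERY translation-invariant ground state of the sourced model at `(μ, h)` (a finite-`h` RESPONSE floor,
not an order parameter). The cap row is discharged state-free: `e^{src}(σ) = E(h) ≤ u` on the class.
[cite: WangEtAl2024, §III] [cite: AraujoEtAl2023, §3.2 Prop. 11] [cite: KomaTasaki1994, §1] -/
theorem gsClass_re_expect_localPairAt_ge_of_twistedFlip_certificate_kkt_of_energyUpperRow (tp U μ h : ℝ)
    {Λ Λ' : Finset (Site 2)} (hΛ : Λ ⊆ Λ') (h8 : thicken Λ 1 ⊆ Λ') (h0 : thicken ({0} : Finset (Site 2)) 1 ⊆ Λ')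
    (hP : pairRegion (insert (0 : Site 2) unitSteps) 0 ⊆ Λ') {κp : ℝ} (hκ : 0 ≤ κp) {u : ℚ} {q L₀ : ℕ} (hq : 0 < q)
    (hrow : SourcedEnergyUpperRow tp U μ h q L₀ u)
    {m : Type*} [Fintype m] [DecidableEq m] {Λm : Matrix m m ℂ} (hΛm : Λm.PosSemidef) (O : m → FermionOp Λ')
    {κ' : Type*} (s : Finset κ') (B : κ' → FermionOp Λ)
    {ι : Type*} (tt : Finset ι) (γ : ι → DihedralGroup 4) (wv : ι → Site 2) (fl mt : ι → Fin 2)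
    (hsh : ∀ l, d4ShiftSet (γ l) (wv l) Λ ⊆ Λ') (bb : ι → ℂ) (yw : ι → List (Orb (PolySite Λ) × Bool))
    {δ : Type*} (ah : Finset δ) (dc : δ → ℝ) (V : δ → FermionOp Λ')
    {κ'' : Type*} (w : Finset κ'') (a : κ'' → ℂ) (word : κ'' → List (Orb (PolySite Λ') × Bool))
    {β : Type*} [Fintype β] [DecidableEq β] {G : Matrix β β ℂ} (hG : G.PosSemidef) (Bk : β → FermionOp Λ) {c mfl : ℝ}
    (hm : 2 * mfl ≤ c - ∑ k ∈ w, ‖a k‖)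
    (hcert : (fermionEmbed (PolySite.incl hP) (localPairAt (insert (0 : Site 2) unitSteps) dWaveFormFactor 0) +
          (fermionEmbed (PolySite.incl hP) (localPairAt (insert (0 : Site 2) unitSteps) dWaveFormFactor 0))ᴴ) -
        (c : ℂ) • (1 : FermionOp Λ') -
        ((κp : ℝ) : ℂ) • ((((u : ℚ) : ℝ) : ℂ) • (1 : FermionOp Λ') -
          fermionEmbed (PolySite.incl h0) ((hubbardTTPrimeSourcedInteraction 1 tp U μ dWaveFormFactor h).meanEnergyObs 1)) =
      gramForm Λm O +
        (∑ k ∈ s, (pairSourceWindowHamiltonianTT' dWaveFormFactor Λ' tp U μ h * fermionEmbed (PolySite.incl hΛ) (B k) -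
            fermionEmbed (PolySite.incl hΛ) (B k) * pairSourceWindowHamiltonianTT' dWaveFormFactor Λ' tp U μ h) +
          ∑ l ∈ tt, bb l • (gaugePhase (twistFlipExp (γ l) (fl l) (mt l)) (yw l) •
              fermionEmbed (PolySite.incl (hsh l))
                (fermionEmbed (PolySite.d4Emb (γ l) (wv l) Λ) (spinSwapIter (fl l).val (ladderWord (yw l)))) -
            fermionEmbed (PolySite.incl hΛ) (ladderWord (yw l)))) +
        (∑ m' ∈ ah, ((dc m' : ℝ) : ℂ) • ((V m')ᴴ - V m') + ∑ k ∈ w, a k • ladderWord (word k)) +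
        kktForm (pairSourceWindowHamiltonianTT' dWaveFormFactor Λ' tp U μ h) G
          (fun b' => fermionEmbed (PolySite.incl hΛ) (Bk b'))) :
    ∀ σ : InfVolFermionState 2, σ.IsMeanEnergyMinimiser (hubbardTTPrimeSourcedInteraction 1 tp U μ dWaveFormFactor h) 1 →
      mfl ≤ (σ.expect (pairRegion (insert (0 : Site 2) unitSteps) 0)
        (localPairAt (insert (0 : Site 2) unitSteps) dWaveFormFactor 0)).re := by
  intro σ hσ
  have hz : (0 : Site 2) ∈ Λ' := h0 (subset_thicken _ _ (Finset.mem_singleton_self 0))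
  have hu : dWaveSourceEnergyDensityTT' tp U μ h ≤ ((u : ℚ) : ℝ) := hrow.dWaveSourceEnergyDensityTT'_le hq
  have hcert' : (fermionEmbed (PolySite.incl hP) (localPairAt (insert (0 : Site 2) unitSteps) dWaveFormFactor 0) +
          (fermionEmbed (PolySite.incl hP) (localPairAt (insert (0 : Site 2) unitSteps) dWaveFormFactor 0))ᴴ) -
        (c : ℂ) • (1 : FermionOp Λ') -
        ∑ σ : Fin 2, (((0 : ℝ) : ℝ) : ℂ) • (nAt 0 hz σ - (((0 : ℝ) : ℝ) : ℂ) • (1 : FermionOp Λ')) -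
        ((κp : ℝ) : ℂ) • ((((u : ℚ) : ℝ) : ℂ) • (1 : FermionOp Λ') -
          fermionEmbed (PolySite.incl h0) ((hubbardTTPrimeSourcedInteraction 1 tp U μ dWaveFormFactor h).meanEnergyObs 1)) -
        (((0 : ℝ) : ℝ) : ℂ) • (fermionEmbed (PolySite.incl h0) ((hubbardTTPrimeFermionInteraction 1 tp U).meanEnergyObs 1) -
          (((0 : ℝ) : ℝ) : ℂ) • (1 : FermionOp Λ')) =
      gramForm Λm O +
        (∑ k ∈ s, (pairSourceWindowHamiltonianTT' dWaveFormFactor Λ' tp U μ h * fermionEmbed (PolySite.incl hΛ) (B k) -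
            fermionEmbed (PolySite.incl hΛ) (B k) * pairSourceWindowHamiltonianTT' dWaveFormFactor Λ' tp U μ h) +
          ∑ l ∈ tt, bb l • (gaugePhase (twistFlipExp (γ l) (fl l) (mt l)) (yw l) •
              fermionEmbed (PolySite.incl (hsh l))
                (fermionEmbed (PolySite.d4Emb (γ l) (wv l) Λ) (spinSwapIter (fl l).val (ladderWord (yw l)))) -
            fermionEmbed (PolySite.incl hΛ) (ladderWord (yw l)))) +
        (∑ m' ∈ ah, ((dc m' : ℝ) : ℂ) • ((V m')ᴴ - V m') + ∑ k ∈ w, a k • ladderWord (word k)) +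
        kktForm (pairSourceWindowHamiltonianTT' dWaveFormFactor Λ' tp U μ h) G
          (fun b' => fermionEmbed (PolySite.incl hΛ) (Bk b')) := by
    simp only [Complex.ofReal_zero, zero_smul, Finset.sum_const_zero, sub_zero]
    exact hcert
  have hmain := hσ.le_two_mul_re_expect_localPairAt_of_twistedFlip_certificate_kkt hΛ h8 h0 hz hP κp 0 ((u : ℚ) : ℝ) 0
    (fun _ => 0) 0 (hσ.mul_meanEnergy_sourced_le_of_le hκ hu) (fun _ _ _ => by simp only [zero_mul, le_refl]) hΛm O s B
    tt γ wv fl mt hsh bb yw ah dc V w a word hG Bk hcert'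
  simp only [Finset.sum_const_zero, zero_mul, add_zero] at hmain
  linarith

/-- **K-LEG FLOOR, STATE-FREE (Griffiths' left edge)**: the same certificate and cap cell prove `m ≤ −∂⁻E(h)/2`,
`E = dWaveSourceEnergyDensityTT' tp U μ` — the smallest induced pair amplitude over the translation-invariant ground states at
field `h` (attained in the class). The cell's h-chords floor the SAME number (`(E(h₁) − E(h))/(2(h − h₁)) ≤ −∂⁻E(h)/2` by
concavity), so a K-leg floor and a chord floor at one field are comparable. [cite: Griffiths1966, §II] [cite: KomaTasaki1994, §1] -/
theorem gsClass_neg_leftDeriv_ge_of_twistedFlip_certificate_kkt_of_energyUpperRow (tp U μ h : ℝ)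
    {Λ Λ' : Finset (Site 2)} (hΛ : Λ ⊆ Λ') (h8 : thicken Λ 1 ⊆ Λ') (h0 : thicken ({0} : Finset (Site 2)) 1 ⊆ Λ')
    (hP : pairRegion (insert (0 : Site 2) unitSteps) 0 ⊆ Λ') {κp : ℝ} (hκ : 0 ≤ κp) {u : ℚ} {q L₀ : ℕ} (hq : 0 < q)
    (hrow : SourcedEnergyUpperRow tp U μ h q L₀ u)
    {m : Type*} [Fintype m] [DecidableEq m] {Λm : Matrix m m ℂ} (hΛm : Λm.PosSemidef) (O : m → FermionOp Λ')
    {κ' : Type*} (s : Finset κ') (B : κ' → FermionOp Λ)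
    {ι : Type*} (tt : Finset ι) (γ : ι → DihedralGroup 4) (wv : ι → Site 2) (fl mt : ι → Fin 2)
    (hsh : ∀ l, d4ShiftSet (γ l) (wv l) Λ ⊆ Λ') (bb : ι → ℂ) (yw : ι → List (Orb (PolySite Λ) × Bool))
    {δ : Type*} (ah : Finset δ) (dc : δ → ℝ) (V : δ → FermionOp Λ')
    {κ'' : Type*} (w : Finset κ'') (a : κ'' → ℂ) (word : κ'' → List (Orb (PolySite Λ') × Bool))
    {β : Type*} [Fintype β] [DecidableEq β] {G : Matrix β β ℂ} (hG : G.PosSemidef) (Bk : β → FermionOp Λ) {c mfl : ℝ}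
    (hm : 2 * mfl ≤ c - ∑ k ∈ w, ‖a k‖)
    (hcert : (fermionEmbed (PolySite.incl hP) (localPairAt (insert (0 : Site 2) unitSteps) dWaveFormFactor 0) +
          (fermionEmbed (PolySite.incl hP) (localPairAt (insert (0 : Site 2) unitSteps) dWaveFormFactor 0))ᴴ) -
        (c : ℂ) • (1 : FermionOp Λ') -
        ((κp : ℝ) : ℂ) • ((((u : ℚ) : ℝ) : ℂ) • (1 : FermionOp Λ') -
          fermionEmbed (PolySite.incl h0) ((hubbardTTPrimeSourcedInteraction 1 tp U μ dWaveFormFactor h).meanEnergyObs 1)) =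
      gramForm Λm O +
        (∑ k ∈ s, (pairSourceWindowHamiltonianTT' dWaveFormFactor Λ' tp U μ h * fermionEmbed (PolySite.incl hΛ) (B k) -
            fermionEmbed (PolySite.incl hΛ) (B k) * pairSourceWindowHamiltonianTT' dWaveFormFactor Λ' tp U μ h) +
          ∑ l ∈ tt, bb l • (gaugePhase (twistFlipExp (γ l) (fl l) (mt l)) (yw l) •
              fermionEmbed (PolySite.incl (hsh l))
                (fermionEmbed (PolySite.d4Emb (γ l) (wv l) Λ) (spinSwapIter (fl l).val (ladderWord (yw l)))) -
            fermionEmbed (PolySite.incl hΛ) (ladderWord (yw l)))) +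
        (∑ m' ∈ ah, ((dc m' : ℝ) : ℂ) • ((V m')ᴴ - V m') + ∑ k ∈ w, a k • ladderWord (word k)) +
        kktForm (pairSourceWindowHamiltonianTT' dWaveFormFactor Λ' tp U μ h) G
          (fun b' => fermionEmbed (PolySite.incl hΛ) (Bk b'))) :
    mfl ≤ -derivWithin (dWaveSourceEnergyDensityTT' tp U μ) (Set.Iio h) h / 2 := by
  have hu : dWaveSourceEnergyDensityTT' tp U μ h ≤ ((u : ℚ) : ℝ) := hrow.dWaveSourceEnergyDensityTT'_le hq
  have hmain := neg_leftDeriv_dWaveSourceEnergyDensityTT'_ge_of_gs_certificate_kkt tp U μ h hΛ h8 h0 hP hκ hu hΛm O s B tt γ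
    wv fl mt hsh bb yw ah dc V w a word hG Bk hcert
  linarith

/-- **K-LEG FLOOR in the engine's units** (`m̃ = √2·Re σ(P₀^d)`, slot `√2·M̃ ≤ c − Σ‖aₖ‖`): the same certificate and cap cell
prove `∀ σ` in the class, `M̃ ≤ √2·Re σ(P₀^d)`. [cite: KomaTasaki1994, §1] [cite: WangEtAl2024, §III] -/
theorem gsClass_sqrt_two_mul_re_expect_localPairAt_ge_of_twistedFlip_certificate_kkt_of_energyUpperRow (tp U μ h : ℝ)
    {Λ Λ' : Finset (Site 2)} (hΛ : Λ ⊆ Λ') (h8 : thicken Λ 1 ⊆ Λ') (h0 : thicken ({0} : Finset (Site 2)) 1 ⊆ Λ')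
    (hP : pairRegion (insert (0 : Site 2) unitSteps) 0 ⊆ Λ') {κp : ℝ} (hκ : 0 ≤ κp) {u : ℚ} {q L₀ : ℕ} (hq : 0 < q)
    (hrow : SourcedEnergyUpperRow tp U μ h q L₀ u)
    {m : Type*} [Fintype m] [DecidableEq m] {Λm : Matrix m m ℂ} (hΛm : Λm.PosSemidef) (O : m → FermionOp Λ')
    {κ' : Type*} (s : Finset κ') (B : κ' → FermionOp Λ)
    {ι : Type*} (tt : Finset ι) (γ : ι → DihedralGroup 4) (wv : ι → Site 2) (fl mt : ι → Fin 2)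
    (hsh : ∀ l, d4ShiftSet (γ l) (wv l) Λ ⊆ Λ') (bb : ι → ℂ) (yw : ι → List (Orb (PolySite Λ) × Bool))
    {δ : Type*} (ah : Finset δ) (dc : δ → ℝ) (V : δ → FermionOp Λ')
    {κ'' : Type*} (w : Finset κ'') (a : κ'' → ℂ) (word : κ'' → List (Orb (PolySite Λ') × Bool))
    {β : Type*} [Fintype β] [DecidableEq β] {G : Matrix β β ℂ} (hG : G.PosSemidef) (Bk : β → FermionOp Λ) {c M : ℝ}
    (hM : Real.sqrt 2 * M ≤ c - ∑ k ∈ w, ‖a k‖)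
    (hcert : (fermionEmbed (PolySite.incl hP) (localPairAt (insert (0 : Site 2) unitSteps) dWaveFormFactor 0) +
          (fermionEmbed (PolySite.incl hP) (localPairAt (insert (0 : Site 2) unitSteps) dWaveFormFactor 0))ᴴ) -
        (c : ℂ) • (1 : FermionOp Λ') -
        ((κp : ℝ) : ℂ) • ((((u : ℚ) : ℝ) : ℂ) • (1 : FermionOp Λ') -
          fermionEmbed (PolySite.incl h0) ((hubbardTTPrimeSourcedInteraction 1 tp U μ dWaveFormFactor h).meanEnergyObs 1)) =
      gramForm Λm O +
        (∑ k ∈ s, (pairSourceWindowHamiltonianTT' dWaveFormFactor Λ' tp U μ h * fermionEmbed (PolySite.incl hΛ) (B k) -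
            fermionEmbed (PolySite.incl hΛ) (B k) * pairSourceWindowHamiltonianTT' dWaveFormFactor Λ' tp U μ h) +
          ∑ l ∈ tt, bb l • (gaugePhase (twistFlipExp (γ l) (fl l) (mt l)) (yw l) •
              fermionEmbed (PolySite.incl (hsh l))
                (fermionEmbed (PolySite.d4Emb (γ l) (wv l) Λ) (spinSwapIter (fl l).val (ladderWord (yw l)))) -
            fermionEmbed (PolySite.incl hΛ) (ladderWord (yw l)))) +
        (∑ m' ∈ ah, ((dc m' : ℝ) : ℂ) • ((V m')ᴴ - V m') + ∑ k ∈ w, a k • ladderWord (word k)) +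
        kktForm (pairSourceWindowHamiltonianTT' dWaveFormFactor Λ' tp U μ h) G
          (fun b' => fermionEmbed (PolySite.incl hΛ) (Bk b'))) :
    ∀ σ : InfVolFermionState 2, σ.IsMeanEnergyMinimiser (hubbardTTPrimeSourcedInteraction 1 tp U μ dWaveFormFactor h) 1 →
      M ≤ Real.sqrt 2 * (σ.expect (pairRegion (insert (0 : Site 2) unitSteps) 0)
        (localPairAt (insert (0 : Site 2) unitSteps) dWaveFormFactor 0)).re := by
  intro σ hσ
  have hhalf : 2 * ((c - ∑ k ∈ w, ‖a k‖) / 2) ≤ c - ∑ k ∈ w, ‖a k‖ := by linarith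
  have hmain := gsClass_re_expect_localPairAt_ge_of_twistedFlip_certificate_kkt_of_energyUpperRow tp U μ h hΛ h8 h0 hP hκ hq
    hrow hΛm O s B tt γ wv fl mt hsh bb yw ah dc V w a word hG Bk hhalf hcert σ hσ
  exact le_sqrt_two_mul_of_sqrt_two_mul_le hM (by linarith)

end Floor

/-! ## §3 Response-CEILING K-legs (pair MAX with ground-state rows and a cap cell) -/

section Ceiling

variable {tp U μ h : ℝ}

/-- **K-LEG CEILING NODE SHAPE, on the ground-state class**: the MAX program (objective `−(Γ P₀^d + (Γ P₀^d)ᴴ)`) with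
ground-state rows, cap row `κ⁺ ((u:ℚ)·1 − Γ E^{src}_h)` (`κ⁺ ≥ 0`), a certified cap cell `SourcedEnergyUpperRow tp U μ h q L₀ u`
and a slot `−(c − Σ‖aₖ‖) ≤ 2M` proves `∀ σ` in the class, `Re σ(P₀^d) ≤ M` — a finite-`h` RESPONSE ceiling on every
translation-invariant ground state (sharper class than «every translation-invariant state with `e^{src} ≤ u`» of the
cap-only M-nodes, because the ground-state rows bind). [cite: KomaTasaki1994, §1] [cite: WangEtAl2024, §III] -/
theorem gsClass_re_expect_localPairAt_le_of_twistedFlip_certificate_kkt_of_energyUpperRow (tp U μ h : ℝ)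
    {Λ Λ' : Finset (Site 2)} (hΛ : Λ ⊆ Λ') (h8 : thicken Λ 1 ⊆ Λ') (h0 : thicken ({0} : Finset (Site 2)) 1 ⊆ Λ')
    (hP : pairRegion (insert (0 : Site 2) unitSteps) 0 ⊆ Λ') {κp : ℝ} (hκ : 0 ≤ κp) {u : ℚ} {q L₀ : ℕ} (hq : 0 < q)
    (hrow : SourcedEnergyUpperRow tp U μ h q L₀ u)
    {m : Type*} [Fintype m] [DecidableEq m] {Λm : Matrix m m ℂ} (hΛm : Λm.PosSemidef) (O : m → FermionOp Λ')
    {κ' : Type*} (s : Finset κ') (B : κ' → FermionOp Λ)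
    {ι : Type*} (tt : Finset ι) (γ : ι → DihedralGroup 4) (wv : ι → Site 2) (fl mt : ι → Fin 2)
    (hsh : ∀ l, d4ShiftSet (γ l) (wv l) Λ ⊆ Λ') (bb : ι → ℂ) (yw : ι → List (Orb (PolySite Λ) × Bool))
    {δ : Type*} (ah : Finset δ) (dc : δ → ℝ) (V : δ → FermionOp Λ')
    {κ'' : Type*} (w : Finset κ'') (a : κ'' → ℂ) (word : κ'' → List (Orb (PolySite Λ') × Bool))
    {β : Type*} [Fintype β] [DecidableEq β] {G : Matrix β β ℂ} (hG : G.PosSemidef) (Bk : β → FermionOp Λ) {c M : ℝ}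
    (hM : -(c - ∑ k ∈ w, ‖a k‖) ≤ 2 * M)
    (hcert : -(fermionEmbed (PolySite.incl hP) (localPairAt (insert (0 : Site 2) unitSteps) dWaveFormFactor 0) +
          (fermionEmbed (PolySite.incl hP) (localPairAt (insert (0 : Site 2) unitSteps) dWaveFormFactor 0))ᴴ) -
        (c : ℂ) • (1 : FermionOp Λ') -
        ((κp : ℝ) : ℂ) • ((((u : ℚ) : ℝ) : ℂ) • (1 : FermionOp Λ') -
          fermionEmbed (PolySite.incl h0) ((hubbardTTPrimeSourcedInteraction 1 tp U μ dWaveFormFactor h).meanEnergyObs 1)) =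
      gramForm Λm O +
        (∑ k ∈ s, (pairSourceWindowHamiltonianTT' dWaveFormFactor Λ' tp U μ h * fermionEmbed (PolySite.incl hΛ) (B k) -
            fermionEmbed (PolySite.incl hΛ) (B k) * pairSourceWindowHamiltonianTT' dWaveFormFactor Λ' tp U μ h) +
          ∑ l ∈ tt, bb l • (gaugePhase (twistFlipExp (γ l) (fl l) (mt l)) (yw l) •
              fermionEmbed (PolySite.incl (hsh l))
                (fermionEmbed (PolySite.d4Emb (γ l) (wv l) Λ) (spinSwapIter (fl l).val (ladderWord (yw l)))) -
            fermionEmbed (PolySite.incl hΛ) (ladderWord (yw l)))) +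
        (∑ m' ∈ ah, ((dc m' : ℝ) : ℂ) • ((V m')ᴴ - V m') + ∑ k ∈ w, a k • ladderWord (word k)) +
        kktForm (pairSourceWindowHamiltonianTT' dWaveFormFactor Λ' tp U μ h) G
          (fun b' => fermionEmbed (PolySite.incl hΛ) (Bk b'))) :
    ∀ σ : InfVolFermionState 2, σ.IsMeanEnergyMinimiser (hubbardTTPrimeSourcedInteraction 1 tp U μ dWaveFormFactor h) 1 →
      (σ.expect (pairRegion (insert (0 : Site 2) unitSteps) 0)
        (localPairAt (insert (0 : Site 2) unitSteps) dWaveFormFactor 0)).re ≤ M := by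
  intro σ hσ
  have hz : (0 : Site 2) ∈ Λ' := h0 (subset_thicken _ _ (Finset.mem_singleton_self 0))
  have hu : dWaveSourceEnergyDensityTT' tp U μ h ≤ ((u : ℚ) : ℝ) := hrow.dWaveSourceEnergyDensityTT'_le hq
  have hcert' : -(fermionEmbed (PolySite.incl hP) (localPairAt (insert (0 : Site 2) unitSteps) dWaveFormFactor 0) +
          (fermionEmbed (PolySite.incl hP) (localPairAt (insert (0 : Site 2) unitSteps) dWaveFormFactor 0))ᴴ) -
        (c : ℂ) • (1 : FermionOp Λ') -
        ∑ σ : Fin 2, (((0 : ℝ) : ℝ) : ℂ) • (nAt 0 hz σ - (((0 : ℝ) : ℝ) : ℂ) • (1 : FermionOp Λ')) -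
        ((κp : ℝ) : ℂ) • ((((u : ℚ) : ℝ) : ℂ) • (1 : FermionOp Λ') -
          fermionEmbed (PolySite.incl h0) ((hubbardTTPrimeSourcedInteraction 1 tp U μ dWaveFormFactor h).meanEnergyObs 1)) -
        (((0 : ℝ) : ℝ) : ℂ) • (fermionEmbed (PolySite.incl h0) ((hubbardTTPrimeFermionInteraction 1 tp U).meanEnergyObs 1) -
          (((0 : ℝ) : ℝ) : ℂ) • (1 : FermionOp Λ')) =
      gramForm Λm O +
        (∑ k ∈ s, (pairSourceWindowHamiltonianTT' dWaveFormFactor Λ' tp U μ h * fermionEmbed (PolySite.incl hΛ) (B k) -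
            fermionEmbed (PolySite.incl hΛ) (B k) * pairSourceWindowHamiltonianTT' dWaveFormFactor Λ' tp U μ h) +
          ∑ l ∈ tt, bb l • (gaugePhase (twistFlipExp (γ l) (fl l) (mt l)) (yw l) •
              fermionEmbed (PolySite.incl (hsh l))
                (fermionEmbed (PolySite.d4Emb (γ l) (wv l) Λ) (spinSwapIter (fl l).val (ladderWord (yw l)))) -
            fermionEmbed (PolySite.incl hΛ) (ladderWord (yw l)))) +
        (∑ m' ∈ ah, ((dc m' : ℝ) : ℂ) • ((V m')ᴴ - V m') + ∑ k ∈ w, a k • ladderWord (word k)) +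
        kktForm (pairSourceWindowHamiltonianTT' dWaveFormFactor Λ' tp U μ h) G
          (fun b' => fermionEmbed (PolySite.incl hΛ) (Bk b')) := by
    simp only [Complex.ofReal_zero, zero_smul, Finset.sum_const_zero, sub_zero]
    exact hcert
  have hmain := hσ.two_mul_re_expect_localPairAt_le_of_twistedFlip_certificate_kkt hΛ h8 h0 hz hP κp 0 ((u : ℚ) : ℝ) 0
    (fun _ => 0) 0 (hσ.mul_meanEnergy_sourced_le_of_le hκ hu) (fun _ _ _ => by simp only [zero_mul, le_refl]) hΛm O s B
    tt γ wv fl mt hsh bb yw ah dc V w a word hG Bk hcert'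
  simp only [Finset.sum_const_zero, zero_mul, add_zero] at hmain
  linarith

/-- **K-LEG CEILING, STATE-FREE (Griffiths' right edge)**: the same certificate and cap cell prove `−∂⁺E(h)/2 ≤ M` — the
largest induced pair amplitude over the translation-invariant ground states at field `h` (attained).
[cite: Griffiths1966, §II] [cite: KomaTasaki1994, §1] -/
theorem gsClass_neg_rightDeriv_le_of_twistedFlip_certificate_kkt_of_energyUpperRow (tp U μ h : ℝ)
    {Λ Λ' : Finset (Site 2)} (hΛ : Λ ⊆ Λ') (h8 : thicken Λ 1 ⊆ Λ') (h0 : thicken ({0} : Finset (Site 2)) 1 ⊆ Λ')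
    (hP : pairRegion (insert (0 : Site 2) unitSteps) 0 ⊆ Λ') {κp : ℝ} (hκ : 0 ≤ κp) {u : ℚ} {q L₀ : ℕ} (hq : 0 < q)
    (hrow : SourcedEnergyUpperRow tp U μ h q L₀ u)
    {m : Type*} [Fintype m] [DecidableEq m] {Λm : Matrix m m ℂ} (hΛm : Λm.PosSemidef) (O : m → FermionOp Λ')
    {κ' : Type*} (s : Finset κ') (B : κ' → FermionOp Λ)
    {ι : Type*} (tt : Finset ι) (γ : ι → DihedralGroup 4) (wv : ι → Site 2) (fl mt : ι → Fin 2)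
    (hsh : ∀ l, d4ShiftSet (γ l) (wv l) Λ ⊆ Λ') (bb : ι → ℂ) (yw : ι → List (Orb (PolySite Λ) × Bool))
    {δ : Type*} (ah : Finset δ) (dc : δ → ℝ) (V : δ → FermionOp Λ')
    {κ'' : Type*} (w : Finset κ'') (a : κ'' → ℂ) (word : κ'' → List (Orb (PolySite Λ') × Bool))
    {β : Type*} [Fintype β] [DecidableEq β] {G : Matrix β β ℂ} (hG : G.PosSemidef) (Bk : β → FermionOp Λ) {c M : ℝ}
    (hM : -(c - ∑ k ∈ w, ‖a k‖) ≤ 2 * M)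
    (hcert : -(fermionEmbed (PolySite.incl hP) (localPairAt (insert (0 : Site 2) unitSteps) dWaveFormFactor 0) +
          (fermionEmbed (PolySite.incl hP) (localPairAt (insert (0 : Site 2) unitSteps) dWaveFormFactor 0))ᴴ) -
        (c : ℂ) • (1 : FermionOp Λ') -
        ((κp : ℝ) : ℂ) • ((((u : ℚ) : ℝ) : ℂ) • (1 : FermionOp Λ') -
          fermionEmbed (PolySite.incl h0) ((hubbardTTPrimeSourcedInteraction 1 tp U μ dWaveFormFactor h).meanEnergyObs 1)) =
      gramForm Λm O +
        (∑ k ∈ s, (pairSourceWindowHamiltonianTT' dWaveFormFactor Λ' tp U μ h * fermionEmbed (PolySite.incl hΛ) (B k) -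
            fermionEmbed (PolySite.incl hΛ) (B k) * pairSourceWindowHamiltonianTT' dWaveFormFactor Λ' tp U μ h) +
          ∑ l ∈ tt, bb l • (gaugePhase (twistFlipExp (γ l) (fl l) (mt l)) (yw l) •
              fermionEmbed (PolySite.incl (hsh l))
                (fermionEmbed (PolySite.d4Emb (γ l) (wv l) Λ) (spinSwapIter (fl l).val (ladderWord (yw l)))) -
            fermionEmbed (PolySite.incl hΛ) (ladderWord (yw l)))) +
        (∑ m' ∈ ah, ((dc m' : ℝ) : ℂ) • ((V m')ᴴ - V m') + ∑ k ∈ w, a k • ladderWord (word k)) +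
        kktForm (pairSourceWindowHamiltonianTT' dWaveFormFactor Λ' tp U μ h) G
          (fun b' => fermionEmbed (PolySite.incl hΛ) (Bk b'))) :
    -derivWithin (dWaveSourceEnergyDensityTT' tp U μ) (Set.Ioi h) h / 2 ≤ M := by
  have hu : dWaveSourceEnergyDensityTT' tp U μ h ≤ ((u : ℚ) : ℝ) := hrow.dWaveSourceEnergyDensityTT'_le hq
  have hmain := neg_rightDeriv_dWaveSourceEnergyDensityTT'_le_of_gs_certificate_kkt tp U μ h hΛ h8 h0 hP hκ hu hΛm O s B tt γ
    wv fl mt hsh bb yw ah dc V w a word hG Bk hcert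
  linarith

end Ceiling

end Summit.Ventures.CertifiedManyBodySolver

end
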